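import Literature.Analysis.FluidPDE.ElgindiEllipticWeakEquation
import Literature.Analysis.FluidPDE.ElgindiEllipticGraphRelations
import HarnessLib

/-!
# The very weak (distributional) form of Elgindi's polar elliptic equation for weak solutions
([Elgindi2021] §7.1, Proposition 7.1)

Topic `Literature/Analysis/FluidPDE`. Support file (definitions with bodies and proved theorems, no
named facts) on the proof path of the named fact
`Literature.Analysis.FluidPDE.Elgindi.ElgindiGhoulMasmoudi2021_stabilityCore`
(`ElgindiStabilityDecomposition.lean`). T. M. Elgindi, Ann. of Math. 194 (2021) =
arXiv:1904.04795, §7.1 Proposition 7.1 (p. 19 of the held text: "the unique `L²` solution to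
(PolarBSL) … existence and uniqueness follows from the standard `L^p` theory").

For the weak solution `U = (U₀, U₁, U₂, U₃)` of `ElgindiEllipticWeakExistence.lean` with datum
`F ⊥ K` we derive the distributional equation for its first component:
`∫∫_strip U₀ · ᵗL(Φ) = ∫∫_strip F · Φ` for every smooth `Φ` compactly supported in the open strip
(`integral_weakSol_transposeOp`), where
`ᵗL(Φ) = −α²R²Φ_RR + (5α − 3α²)RΦ_R − Φ_θθ − tan θΦ_θ + (5α − α² − 6)Φ` (`transposeOp`) is the
formal transpose of `L`. Proof: test the weak equation against `Jχ₂` with `cos θ·χ₂ = Φ`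
(`weakSolution_test`), and convert the pairings with `U₁, U₂, U₃` into pairings with `U₀` by the
graph relations (`weakSpace_inner_one/two/three`). This is the input of interior elliptic
regularity (Folland's Cor. (6.34), the tree's `Folland1995_cor634_holds`).
-/

noncomputable section

open MeasureTheory Set Real Filter Function
open _root_.Topology
open scoped ENNReal InnerProductSpace

namespace Literature.Analysis.FluidPDE

namespace Elgindi

/-! ### The formal transpose -/

/-- **The formal transpose of `L`**:
`ᵗL(Φ) = −α²R²Φ_RR + (5α − 3α²)RΦ_R − Φ_θθ − tan θΦ_θ + (5α − α² − 6)Φ`. [folklore] -/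
def transposeOp (α : ℝ) (Φ : ℝ → ℝ → ℝ) (p : ℝ × ℝ) : ℝ :=
  -α ^ 2 * p.1 ^ 2 * dz (dz Φ) p.1 p.2 + (5 * α - 3 * α ^ 2) * p.1 * dz Φ p.1 p.2 - dθ (dθ Φ) p.1 p.2 -
    Real.tan p.2 * dθ Φ p.1 p.2 + (5 * α - α ^ 2 - 6) * Φ p.1 p.2

/-- Unfolding `transposeOp`. [folklore] -/
theorem transposeOp_apply (α : ℝ) (Φ : ℝ → ℝ → ℝ) (p : ℝ × ℝ) :
    transposeOp α Φ p = -α ^ 2 * p.1 ^ 2 * dz (dz Φ) p.1 p.2 + (5 * α - 3 * α ^ 2) * p.1 * dz Φ p.1 p.2 - dθ (dθ Φ) p.1 p.2 -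
      Real.tan p.2 * dθ Φ p.1 p.2 + (5 * α - α ^ 2 - 6) * Φ p.1 p.2 := rfl

/-! ### Test functions of the open strip: an angular margin and the profile `χ₂ = Φ/cos θ` -/

/-- A compact subset of the open strip keeps an angular margin `δ`. [folklore] -/
theorem exists_angular_margin {K : Set (ℝ × ℝ)} (hK : IsCompact K) (hKS : K ⊆ strip) :
    ∃ δ : ℝ, 0 < δ ∧ δ < π / 4 ∧ ∀ p ∈ K, δ ≤ p.2 ∧ p.2 ≤ π / 2 - δ := by
  by_cases hne : K.Nonempty
  · obtain ⟨p₁, hp₁, h1⟩ := hK.exists_isMinOn hne continuous_snd.continuousOn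
    obtain ⟨p₂, hp₂, h2⟩ := hK.exists_isMaxOn hne continuous_snd.continuousOn
    have a1 : 0 < p₁.2 := (hKS hp₁).2.1
    have a2 : p₂.2 < π / 2 := (hKS hp₂).2.2
    refine ⟨min (min p₁.2 (π / 2 - p₂.2)) (π / 8), lt_min (lt_min a1 (by linarith)) (by positivity),
      lt_of_le_of_lt (min_le_right _ _) (by linarith [Real.pi_pos]), fun p hp => ⟨?_, ?_⟩⟩
    · exact (min_le_left _ _).trans ((min_le_left _ _).trans (h1 hp))
    · have h3 : p.2 ≤ p₂.2 := h2 hp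
      have h4 : min (min p₁.2 (π / 2 - p₂.2)) (π / 8) ≤ π / 2 - p₂.2 := (min_le_left _ _).trans (min_le_right _ _)
      linarith
  · refine ⟨π / 8, by positivity, by linarith [Real.pi_pos], fun p hp => absurd ⟨p, hp⟩ hne⟩

/-- The angular plateau cutoff: `1` on `[δ, π/2 − δ]`, supported in `(δ/2, π/2 − δ/2)`. [folklore] -/
def angularPlateau {δ : ℝ} (hδ : 0 < δ) (hδ' : δ < π / 4) : ContDiffBump (π / 4 : ℝ) :=
  ⟨π / 4 - δ, π / 4 - δ / 2, by linarith, by linarith⟩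

/-- The plateau cutoff is `1` on `[δ, π/2 − δ]`. [folklore] -/
theorem angularPlateau_eq_one {δ : ℝ} (hδ : 0 < δ) (hδ' : δ < π / 4) {θ : ℝ} (h1 : δ ≤ θ) (h2 : θ ≤ π / 2 - δ) :
    (angularPlateau hδ hδ' : ℝ → ℝ) θ = 1 := by
  apply ContDiffBump.one_of_mem_closedBall
  rw [Metric.mem_closedBall, Real.dist_eq, abs_le]
  show -(π / 4 - δ) ≤ θ - π / 4 ∧ θ - π / 4 ≤ π / 4 - δ
  constructor <;> linarith

/-- Off `(δ/2, π/2 − δ/2)` the plateau cutoff vanishes. [folklore] -/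
theorem angularPlateau_eq_zero {δ : ℝ} (hδ : 0 < δ) (hδ' : δ < π / 4) {θ : ℝ} (h : θ ≤ δ / 2 ∨ π / 2 - δ / 2 ≤ θ) :
    (angularPlateau hδ hδ' : ℝ → ℝ) θ = 0 := by
  apply ContDiffBump.zero_of_le_dist
  rw [Real.dist_eq]
  show π / 4 - δ / 2 ≤ |θ - π / 4|
  rcases h with h | h
  · rw [abs_of_neg (by linarith)]; linarith
  · rw [abs_of_nonneg (by linarith)]; linarith

/-- `cos θ > 0` wherever the plateau cutoff does not vanish identically nearby: on `(δ/4, π/2 − δ/4)`. [folklore] -/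
theorem cos_pos_of_near_plateau {δ : ℝ} (hδ : 0 < δ) (hδ' : δ < π / 4) {θ : ℝ} (h1 : δ / 4 < θ) (h2 : θ < π / 2 - δ / 4) :
    0 < Real.cos θ := Real.cos_pos_of_mem_Ioo ⟨by linarith [Real.pi_pos], by linarith⟩

/-- **`η/cos` is smooth on `ℝ`** (`η` the plateau cutoff): near a point of `[δ/2, π/2 − δ/2]ᶜ`-interior
it vanishes identically, elsewhere `cos ≠ 0`. [folklore] -/
theorem contDiff_plateau_div_cos {δ : ℝ} (hδ : 0 < δ) (hδ' : δ < π / 4) {n : ℕ∞} :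
    ContDiff ℝ n fun θ => (angularPlateau hδ hδ' : ℝ → ℝ) θ / Real.cos θ := by
  rw [contDiff_iff_contDiffAt]
  intro θ
  by_cases hθ : δ / 4 < θ ∧ θ < π / 2 - δ / 4
  · have hc : Real.cos θ ≠ 0 := (cos_pos_of_near_plateau hδ hδ' hθ.1 hθ.2).ne'
    exact ((angularPlateau hδ hδ').contDiff.contDiffAt).div (Real.contDiff_cos.contDiffAt) hc
  · -- `η ≡ 0` near `θ`
    have h0 : (fun θ => (angularPlateau hδ hδ' : ℝ → ℝ) θ / Real.cos θ) =ᶠ[𝓝 θ] fun _ => 0 := by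
      rw [not_and_or, not_lt, not_lt] at hθ
      rcases hθ with hθ | hθ
      · filter_upwards [Iio_mem_nhds (show θ < δ / 2 by linarith)] with x hx
        rw [angularPlateau_eq_zero hδ hδ' (Or.inl (le_of_lt hx)), zero_div]
      · filter_upwards [Ioi_mem_nhds (show π / 2 - δ / 2 < θ by linarith)] with x hx
        rw [angularPlateau_eq_zero hδ hδ' (Or.inr (le_of_lt hx)), zero_div]
    exact contDiffAt_const.congr_of_eventuallyEq h0

/-- **The profile `χ₂ = Φ·(η/cos θ)` of a test function of the open strip**: smooth, compactly
supported inside `R > 0`, vanishing on `θ = 0`, with `cos θ·χ₂ = Φ`. [folklore] -/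
theorem exists_profile_of_test {Φ : ℝ → ℝ → ℝ} (hΦ : ∀ n : ℕ, ContDiff ℝ n (uncurry Φ)) (hΦs : HasCompactSupport (uncurry Φ))
    (hΦS : tsupport (uncurry Φ) ⊆ strip) :
    ∃ χ₂ : ℝ → ℝ → ℝ, (∀ n : ℕ, ContDiff ℝ n (uncurry χ₂)) ∧ HasCompactSupport (uncurry χ₂) ∧
      (∀ p ∈ tsupport (uncurry χ₂), 0 < p.1) ∧ (∀ R, χ₂ R 0 = 0) ∧ (fun R θ => Real.cos θ * χ₂ R θ) = Φ := by
  obtain ⟨δ, hδ, hδ', hmar⟩ := exists_angular_margin hΦs.isCompact hΦS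
  set g : ℝ → ℝ := fun θ => (angularPlateau hδ hδ' : ℝ → ℝ) θ / Real.cos θ with hg
  have hgs : ∀ n : ℕ, ContDiff ℝ n g := fun n => contDiff_plateau_div_cos hδ hδ'
  refine ⟨fun R θ => Φ R θ * g θ, fun n => ?_, ?_, fun p hp => ?_, fun R => ?_, ?_⟩
  · have e : uncurry (fun R θ => Φ R θ * g θ) = fun p : ℝ × ℝ => uncurry Φ p * g p.2 := by funext p; rfl
    rw [e]; exact (hΦ n).mul ((hgs n).comp contDiff_snd)
  · have e : uncurry (fun R θ => Φ R θ * g θ) = fun p : ℝ × ℝ => uncurry Φ p * g p.2 := by funext p; rfl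
    rw [e]; exact hΦs.mul_right
  · have e : uncurry (fun R θ => Φ R θ * g θ) = fun p : ℝ × ℝ => uncurry Φ p * g p.2 := by funext p; rfl
    rw [e] at hp
    exact (hΦS (tsupport_mul_subset_left hp)).1
  · have h0 : (R, (0:ℝ)) ∉ tsupport (uncurry Φ) := fun h => by
      have := (hΦS h).2.1; simp at this
    have := image_eq_zero_of_notMem_tsupport h0
    show Φ R 0 * g 0 = 0
    rw [show Φ R 0 = 0 from this, zero_mul]
  · funext R θ
    show Real.cos θ * (Φ R θ * g θ) = Φ R θ
    by_cases hz : Φ R θ = 0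
    · rw [hz, zero_mul, mul_zero]
    · have hmem : (R, θ) ∈ tsupport (uncurry Φ) := subset_tsupport _ (by simpa using hz)
      obtain ⟨h1, h2⟩ := hmar _ hmem
      have hc : Real.cos θ ≠ 0 := (Real.cos_pos_of_mem_Ioo ⟨by linarith [Real.pi_pos], by linarith⟩).ne'
      simp only [hg, angularPlateau_eq_one hδ hδ' h1 h2]
      field_simp

/-- The pairing `⟨U₀, toL2 h⟩` is the strip integral `∫∫ U₀ h`. [folklore] -/
theorem inner_toL2_eq_integral (u : L2Strip) {h : ℝ × ℝ → ℝ} (hh : MemLp h 2 stripMeasure) :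
    ⟪u, toL2 h⟫_ℝ = ∫ p in strip, (u : ℝ × ℝ → ℝ) p * h p := by
  rw [inner_L2Strip]
  refine integral_congr_ae ?_
  filter_upwards [toL2_ae_eq' hh] with p hp
  rw [hp]

/-- `U₀·h` is integrable on the strip for `h ∈ L²`. [folklore] -/
theorem integrable_coe_mul (u : L2Strip) {h : ℝ × ℝ → ℝ} (hh : MemLp h 2 stripMeasure) :
    Integrable (fun p => (u : ℝ × ℝ → ℝ) p * h p) (volume.restrict strip) := by
  have h := (Lp.memLp u).integrable_mul hh
  exact h

/-- `∂_R(αR∂_RΦ) = α(∂_RΦ + R∂_{RR}Φ)`. [folklore] -/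
theorem dz_radialWeight {Φ : ℝ → ℝ → ℝ} (hΦ : ContDiff ℝ 2 (uncurry Φ)) (α R θ : ℝ) :
    dz (fun R θ => α * (R * dz Φ R θ)) R θ = α * (dz Φ R θ + R * dz (dz Φ) R θ) := by
  show deriv (fun R' => α * (R' * dz Φ R' θ)) R = _
  have hd : DifferentiableAt ℝ (fun R' => dz Φ R' θ) R :=
    (((contDiff_dz_of_contDiff (n := 1) hΦ).comp (contDiff_id.prodMk contDiff_const)).differentiable (by simp)) R
  have h1 : HasDerivAt (fun R' => R' * dz Φ R' θ) (1 * dz Φ R θ + R * deriv (fun R' => dz Φ R' θ) R) R :=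
    (hasDerivAt_id R).mul hd.hasDerivAt
  have h2 := h1.const_mul α
  rw [h2.deriv]; simp only [one_mul]; rfl

set_option maxHeartbeats 1600000 in
/-- **The very weak equation**: for a weak solution `U` (in the energy space, `B(U,·) = ⟨F,·₀⟩`)
whose datum is orthogonal to `K` (`∫∫ F·n(R)K(θ) = 0` for radial `n ∈ C_c`), and every smooth `Φ`
compactly supported in the open strip, `∫∫ U₀·ᵗL(Φ) = ∫∫ F·Φ`. [cite: Elgindi2021, §7.1 Proposition 7.1 (p. 19 of arXiv:1904.04795)] -/
theorem integral_weakSol_transposeOp {α : ℝ} {F : L2Strip}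
    (HF : ∀ n : ℝ → ℝ, Continuous n → HasCompactSupport n → ∫ p in strip, (F : ℝ × ℝ → ℝ) p * (n p.1 * kernelK p.2) = 0)
    {U : E4} (hU : U ∈ weakSpace α) (hw : ∀ Ψ ∈ weakSpace α, energyForm α U Ψ = ⟪F, Ψ 0⟫_ℝ)
    {Φ : ℝ → ℝ → ℝ} (hΦ : ∀ n : ℕ, ContDiff ℝ n (uncurry Φ)) (hΦs : HasCompactSupport (uncurry Φ))
    (hΦS : tsupport (uncurry Φ) ⊆ strip) :
    ∫ p in strip, (U 0 : ℝ × ℝ → ℝ) p * transposeOp α Φ p = ∫ p in strip, (F : ℝ × ℝ → ℝ) p * Φ p.1 p.2 := by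
  obtain ⟨χ₂, hχn, hχs, hχpos, hχ0, hcos⟩ := exists_profile_of_test hΦ hΦs hΦS
  have key := weakSolution_test HF hU hw hχn hχs hχpos hχ0
  have hχ1 : ContDiff ℝ 1 (uncurry χ₂) := hχn 1
  have hΦ2 : ContDiff ℝ 2 (uncurry Φ) := hΦ 2
  have hΦ1 : ContDiff ℝ 1 (uncurry Φ) := hΦ 1
  -- the graph components of `Jχ₂`
  have g0 : graphFn α χ₂ 0 = fun p => Φ p.1 p.2 := by
    funext p; show Real.cos p.2 * χ₂ p.1 p.2 = Φ p.1 p.2; rw [← hcos]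
  have g1 : graphFn α χ₂ 1 = fun p => α * (p.1 * dz Φ p.1 p.2) := by
    funext p
    show α * (p.1 * (Real.cos p.2 * dz χ₂ p.1 p.2)) = α * (p.1 * dz Φ p.1 p.2)
    rw [← dz_cosProfile hχ1, hcos]
  have g2 : graphFn α χ₂ 2 = fun p => dθ Φ p.1 p.2 := by
    funext p
    show -Real.sin p.2 * χ₂ p.1 p.2 + Real.cos p.2 * dθ χ₂ p.1 p.2 = dθ Φ p.1 p.2
    rw [← dθ_cosProfile hχ1, hcos]
  rw [energyForm_apply, graphElt_apply, graphElt_apply, graphElt_apply, g0, g1, g2] at key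
  -- the auxiliary test functions and their supports
  obtain ⟨φ₁, hφ₁⟩ : ∃ φ₁ : ℝ → ℝ → ℝ, φ₁ = fun R θ => α * (R * dz Φ R θ) := ⟨_, rfl⟩
  have hφ₁c : ContDiff ℝ 1 (uncurry φ₁) := by
    rw [hφ₁]
    have e : uncurry (fun R θ => α * (R * dz Φ R θ)) = fun p : ℝ × ℝ => α * (p.1 * uncurry (dz Φ) p) := by funext p; rfl
    rw [e]; exact contDiff_const.mul (contDiff_fst.mul (contDiff_dz_of_contDiff (n := 1) hΦ2))
  have hφ₁s : HasCompactSupport (uncurry φ₁) := by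
    rw [hφ₁]
    have e : uncurry (fun R θ => α * (R * dz Φ R θ)) = fun p : ℝ × ℝ => (α * p.1) * uncurry (dz Φ) p := by funext p; simp [uncurry]; ring
    rw [e]; exact (hasCompactSupport_dz hΦs).mul_left
  have hφ₁S : tsupport (uncurry φ₁) ⊆ strip := by
    rw [hφ₁]
    have e : uncurry (fun R θ => α * (R * dz Φ R θ)) = fun p : ℝ × ℝ => (α * p.1) * uncurry (dz Φ) p := by funext p; simp [uncurry]; ring
    rw [e]; exact (tsupport_mul_subset_right.trans tsupport_dz_subset).trans hΦS
  have hφ₂c : ContDiff ℝ 1 (uncurry (dθ Φ)) := contDiff_dθ_of_contDiff (n := 1) hΦ2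
  have hφ₂s : HasCompactSupport (uncurry (dθ Φ)) := hasCompactSupport_dθ_of hΦs
  have hφ₂S : tsupport (uncurry (dθ Φ)) ⊆ strip := (tsupport_dθ_subset' Φ).trans hΦS
  -- the graph relations
  have r1 := weakSpace_inner_one hφ₁c hφ₁s hφ₁S (α := α) hU
  have r1' := weakSpace_inner_one hΦ1 hΦs hΦS (α := α) hU
  have r2 := weakSpace_inner_two hφ₂c hφ₂s hφ₂S (α := α) hU
  have r3 := weakSpace_inner_three hφ₂c hφ₂s hφ₂S (α := α) hU
  simp only [hφ₁, dz_radialWeight hΦ2] at r1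
  rw [r1, r1', r2, r3] at key
  -- everything as strip integrals against `U₀`
  have cΦ : Continuous fun p : ℝ × ℝ => Φ p.1 p.2 := hΦ1.continuous
  have cdz : Continuous fun p : ℝ × ℝ => dz Φ p.1 p.2 := (contDiff_dz_of_contDiff (n := 0) hΦ1).continuous
  have cdz2 : Continuous fun p : ℝ × ℝ => dz (dz Φ) p.1 p.2 :=
    (contDiff_dz_of_contDiff (n := 0) (contDiff_dz_of_contDiff (n := 1) hΦ2)).continuous
  have cdθ : Continuous fun p : ℝ × ℝ => dθ Φ p.1 p.2 := hφ₂c.continuous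
  have cdθ2 : Continuous fun p : ℝ × ℝ => dθ (dθ Φ) p.1 p.2 := (contDiff_dθ_of_contDiff (n := 0) hφ₂c).continuous
  have sdz : HasCompactSupport fun p : ℝ × ℝ => dz Φ p.1 p.2 := hasCompactSupport_dz hΦs
  have sdz2 : HasCompactSupport fun p : ℝ × ℝ => dz (dz Φ) p.1 p.2 := hasCompactSupport_dz (hasCompactSupport_dz hΦs)
  have sdθ : HasCompactSupport fun p : ℝ × ℝ => dθ Φ p.1 p.2 := hφ₂s
  have sdθ2 : HasCompactSupport fun p : ℝ × ℝ => dθ (dθ Φ) p.1 p.2 := hasCompactSupport_dθ_of hφ₂s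
  have sΦ : HasCompactSupport fun p : ℝ × ℝ => Φ p.1 p.2 := hΦs
  set hA : ℝ × ℝ → ℝ := fun p => α * (p.1 * dz Φ p.1 p.2) + p.1 * (α * (dz Φ p.1 p.2 + p.1 * dz (dz Φ) p.1 p.2)) with hhA
  set hB : ℝ × ℝ → ℝ := fun p => Φ p.1 p.2 + p.1 * dz Φ p.1 p.2 with hhB
  set hC : ℝ × ℝ → ℝ := fun p => dθ (dθ Φ) p.1 p.2 with hhC
  set hD : ℝ × ℝ → ℝ := fun p => Real.tan p.2 * dθ Φ p.1 p.2 with hhD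
  set hE : ℝ × ℝ → ℝ := fun p => Φ p.1 p.2 with hhE
  have mA : MemLp hA 2 stripMeasure := memLp_strip_of_continuous (by simp only [hhA]; fun_prop)
    ((sdz.mul_left (f := fun p : ℝ × ℝ => p.1)).mul_left.add ((sdz.add (sdz2.mul_left (f := fun p : ℝ × ℝ => p.1))).mul_left.mul_left))
  have mB : MemLp hB 2 stripMeasure := memLp_strip_of_continuous (by simp only [hhB]; fun_prop) (sΦ.add (sdz.mul_left (f := fun p : ℝ × ℝ => p.1)))
  have mC : MemLp hC 2 stripMeasure := memLp_strip_of_continuous cdθ2 sdθ2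
  have mD : MemLp hD 2 stripMeasure := memLp_strip_of_continuous (continuous_tan_mul_test hφ₂c hφ₂S) sdθ.mul_left
  have mE : MemLp hE 2 stripMeasure := memLp_strip_of_continuous cΦ sΦ
  rw [inner_toL2_eq_integral _ mA, inner_toL2_eq_integral _ mB, inner_toL2_eq_integral _ mC, inner_toL2_eq_integral _ mD,
    inner_toL2_eq_integral _ mE, inner_toL2_eq_integral _ mE] at key
  rw [← key]
  have iA := integrable_coe_mul (U 0) mA
  have iB := integrable_coe_mul (U 0) mB
  have iC := integrable_coe_mul (U 0) mC
  have iD := integrable_coe_mul (U 0) mD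
  have iE := integrable_coe_mul (U 0) mE
  have eT : (fun p : ℝ × ℝ => (U 0 : ℝ × ℝ → ℝ) p * transposeOp α Φ p) = fun p =>
      (-α) * ((U 0 : ℝ × ℝ → ℝ) p * hA p) + (-α * (α - 5)) * ((U 0 : ℝ × ℝ → ℝ) p * hB p) +
        (-1) * ((U 0 : ℝ × ℝ → ℝ) p * hC p) + (-1) * ((U 0 : ℝ × ℝ → ℝ) p * hD p) + (-6) * ((U 0 : ℝ × ℝ → ℝ) p * hE p) := by
    funext p
    simp only [transposeOp_apply, hhA, hhB, hhC, hhD, hhE]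
    ring
  rw [eT, integral_add, integral_add, integral_add, integral_add, MeasureTheory.integral_const_mul, MeasureTheory.integral_const_mul,
    MeasureTheory.integral_const_mul, MeasureTheory.integral_const_mul, MeasureTheory.integral_const_mul]
  · ring
  all_goals first
    | exact iA.const_mul _
    | exact (iA.const_mul _).add (iB.const_mul _)
    | exact ((iA.const_mul _).add (iB.const_mul _)).add (iC.const_mul _)
    | exact (((iA.const_mul _).add (iB.const_mul _)).add (iC.const_mul _)).add (iD.const_mul _)
    | exact iB.const_mul _
    | exact iC.const_mul _
    | exact iD.const_mul _
    | exact iE.const_mul _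

end Elgindi

end Literature.Analysis.FluidPDE
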